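import Summits.NavierStokesRegularity.NavierStokesRegularity.Theorems.ExtremiserTransienceNearExtremalTransienceExtremiserLiouvilleConstantSpeedCalculus
import HarnessLib

/-!
# Crux `ExtremiserTransience.NearExtremalTransience` (stmt-NavierStokesRegularity-21883), line `extremiser_liouville`,
# stub K1b — THE DISCRETE PRODUCT RULE for backward difference quotients (blueprint item L3 of the Piola-slide record)

`--supports stmt-NavierStokesRegularity-21883` (helper).  Author: prover seat `ns-el-k1b` (g8).  Record:
`Cruxes/NearExtremalTransience/Lines/extremiser_liouville_k1b_slide.md` §1(a), §11 (L3).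

The KKT inequality along the Piola slide must be applied to the BACKWARD DIFFERENCE QUOTIENT `D₋ₕV = (V − V(· − he₂))/h` of the
residue (third derivatives of `V` are not known to be square integrable).  The axial integration by parts `∫g⟪F,∂₂F⟫ = −½∫g′‖F‖²`
then becomes an exact discrete identity with a SIGNED remainder:
* `inner_self_sub_eq` : `⟪a, a − b⟫ = ½‖a‖² − ½‖b‖² + ½‖a − b‖²`;
* `integral_axialWeight_inner_backwardQuotient_eq` : for `F` with `‖F‖² ∈ L¹(ℝ³)` and a bounded continuous axial weight `g`,
  **`∫ g(x₂)⟪F(x), F(x) − F(x − he₂)⟫ = ½∫ (g(x₂) − g(x₂+h))‖F(x)‖² + ½∫ g(x₂)‖F(x) − F(x − he₂)‖²`**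
  (translation invariance of Lebesgue measure); dividing by `h`:
  `∫g⟪F, D₋ₕF⟫ = −½∫γ̃_h‖F‖² + (h/2)∫g‖D₋ₕF‖²`, `γ̃_h = (g(·+h) − g)/h → g′`;
* `neg_integral_axialWeight_inner_backwardQuotient_le` : for `g ≥ 0` the remainder is nonnegative, so
  **`−∫g⟪F, F − F(·−he₂)⟫ ≤ ½∫(g(x₂+h) − g(x₂))‖F‖²`** — with `F = ω` (resp. the columns of `Dω`) this is the one-sided
  `W′`- (resp. `Z′`-) estimate that replaces `∫g⟪ω,∂₂ω⟫ = −½∫g′‖ω‖²` in the slide's first variation without any third derivative.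

WHAT THIS IS NOT: K1b is NOT proved; nothing here proves NS regularity. [folklore]
-/

noncomputable section

open Set Filter Topology MeasureTheory Metric Function InnerProductSpace
open scoped ENNReal NNReal Topology InnerProductSpace RealInnerProductSpace ContDiff

namespace Summit.NavierStokesRegularity.NavierStokesRegularity.Theorems

-- the problem directory repeats the summit name (`NavierStokesRegularity/NavierStokesRegularity`)
set_option linter.dupNamespace false

namespace ExtremiserLiouville

variable {F : EuclideanSpace ℝ (Fin 3) → EuclideanSpace ℝ (Fin 3)} {g : ℝ → ℝ}

/-- `⟪a, a − b⟫ = ½‖a‖² − ½‖b‖² + ½‖a − b‖²`. [folklore] -/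
theorem inner_self_sub_eq (a b : EuclideanSpace ℝ (Fin 3)) :
    ⟪a, a - b⟫ = ‖a‖ ^ 2 / 2 - ‖b‖ ^ 2 / 2 + ‖a - b‖ ^ 2 / 2 := by
  rw [inner_sub_right, real_inner_self_eq_norm_sq, norm_sub_sq_real]
  ring

/-- **Discrete product rule** (backward difference quotient, axial weight): for `F` continuous with `‖F‖² ∈ L¹` and `g`
continuous with `|g| ≤ K`:
`∫ g(x₂)⟪F(x), F(x) − F(x − he₂)⟫dx = ½∫(g(x₂) − g(x₂ + h))‖F(x)‖²dx + ½∫g(x₂)‖F(x) − F(x − he₂)‖²dx`. [folklore] -/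
theorem integral_axialWeight_inner_backwardQuotient_eq (hF : Continuous F) (hF2 : Integrable (fun x => ‖F x‖ ^ 2) volume)
    (hg : Continuous g) {K : ℝ} (hgK : ∀ s, |g s| ≤ K) (h : ℝ) :
    (∫ x, g (x 2) * ⟪F x, F x - F (x - h • EuclideanSpace.single (2 : Fin 3) (1 : ℝ))⟫) =
      (1 / 2) * (∫ x, (g (x 2) - g (x 2 + h)) * ‖F x‖ ^ 2) +
        (1 / 2) * ∫ x, g (x 2) * ‖F x - F (x - h • EuclideanSpace.single (2 : Fin 3) (1 : ℝ))‖ ^ 2 := by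
  set e₂ : EuclideanSpace ℝ (Fin 3) := EuclideanSpace.single (2 : Fin 3) (1 : ℝ) with he₂
  have hK0 : 0 ≤ K := (abs_nonneg _).trans (hgK 0)
  have cg : Continuous fun x : EuclideanSpace ℝ (Fin 3) => g (x 2) := hg.comp (PiLp.continuous_apply 2 _ (2 : Fin 3))
  have cgh : Continuous fun x : EuclideanSpace ℝ (Fin 3) => g (x 2 + h) :=
    hg.comp ((PiLp.continuous_apply 2 _ (2 : Fin 3)).add continuous_const)
  have cFm : Continuous fun x => F (x - h • e₂) := hF.comp (continuous_id.sub continuous_const)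
  -- translated square is integrable, and its weighted integral is a translate
  have hFm2 : Integrable (fun x => ‖F (x - h • e₂)‖ ^ 2) volume := by
    have := hF2.comp_sub_right (h • e₂)
    exact this
  have htrans : (∫ x, g (x 2) * ‖F (x - h • e₂)‖ ^ 2) = ∫ x, g (x 2 + h) * ‖F x‖ ^ 2 := by
    have e := integral_sub_right_eq_self (μ := (volume : Measure (EuclideanSpace ℝ (Fin 3))))
      (fun y : EuclideanSpace ℝ (Fin 3) => g (y 2 + h) * ‖F y‖ ^ 2) (h • e₂)
    rw [← e]
    refine integral_congr_ae (Eventually.of_forall fun x => ?_)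
    dsimp only
    congr 2
    simp only [he₂, PiLp.sub_apply, PiLp.smul_apply, smul_eq_mul]; simp
  -- integrability of the weighted pieces
  have iw : ∀ {w : EuclideanSpace ℝ (Fin 3) → ℝ}, Continuous w → (∀ x, |w x| ≤ K) →
      ∀ {G : EuclideanSpace ℝ (Fin 3) → ℝ}, Continuous G → Integrable G volume →
        Integrable (fun x => w x * G x) volume := by
    intro w hw hwK G hG hGi
    refine (hGi.norm.const_mul K).mono' (hw.mul hG).aestronglyMeasurable (Eventually.of_forall fun x => ?_)
    rw [Real.norm_eq_abs, abs_mul, Real.norm_eq_abs]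
    exact mul_le_mul_of_nonneg_right (hwK x) (abs_nonneg _)
  have i1 : Integrable (fun x => g (x 2) * ‖F x‖ ^ 2) volume := iw cg (fun x => hgK _) (hF.norm.pow 2) hF2
  have i2 : Integrable (fun x => g (x 2) * ‖F (x - h • e₂)‖ ^ 2) volume := iw cg (fun x => hgK _) (cFm.norm.pow 2) hFm2
  have i3 : Integrable (fun x => g (x 2 + h) * ‖F x‖ ^ 2) volume := iw cgh (fun x => hgK _) (hF.norm.pow 2) hF2
  have hdiff2 : Integrable (fun x => ‖F x - F (x - h • e₂)‖ ^ 2) volume := by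
    have iM : Integrable (fun x => 2 * (‖F x‖ ^ 2 + ‖F (x - h • e₂)‖ ^ 2)) volume := (hF2.add hFm2).const_mul 2
    refine iM.mono' ((hF.sub cFm).norm.pow 2).aestronglyMeasurable (Eventually.of_forall fun x => ?_)
    rw [Real.norm_eq_abs, abs_of_nonneg (sq_nonneg _)]
    have h1 : ‖F x - F (x - h • e₂)‖ * ‖F x - F (x - h • e₂)‖ ≤ (‖F x‖ + ‖F (x - h • e₂)‖) * (‖F x‖ + ‖F (x - h • e₂)‖) :=
      mul_self_le_mul_self (norm_nonneg _) (norm_sub_le _ _)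
    nlinarith [h1, sq_nonneg (‖F x‖ - ‖F (x - h • e₂)‖)]
  have i4 : Integrable (fun x => g (x 2) * ‖F x - F (x - h • e₂)‖ ^ 2) volume :=
    iw cg (fun x => hgK _) ((hF.sub cFm).norm.pow 2) hdiff2
  -- pointwise identity and integration
  have hpt : ∀ x, g (x 2) * ⟪F x, F x - F (x - h • e₂)⟫ =
      (1 / 2) * (g (x 2) * ‖F x‖ ^ 2) - (1 / 2) * (g (x 2) * ‖F (x - h • e₂)‖ ^ 2) +
        (1 / 2) * (g (x 2) * ‖F x - F (x - h • e₂)‖ ^ 2) := by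
    intro x; rw [inner_self_sub_eq]; ring
  simp_rw [hpt]
  have j1 : Integrable (fun x => 1 / 2 * (g (x 2) * ‖F x‖ ^ 2)) volume := i1.const_mul _
  have j2 : Integrable (fun x => 1 / 2 * (g (x 2) * ‖F (x - h • e₂)‖ ^ 2)) volume := i2.const_mul _
  have j4 : Integrable (fun x => 1 / 2 * (g (x 2) * ‖F x - F (x - h • e₂)‖ ^ 2)) volume := i4.const_mul _
  have j12 : Integrable (fun x => 1 / 2 * (g (x 2) * ‖F x‖ ^ 2) - 1 / 2 * (g (x 2) * ‖F (x - h • e₂)‖ ^ 2)) volume := j1.sub j2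
  rw [integral_add j12 j4, integral_sub j1 j2, integral_const_mul, integral_const_mul, integral_const_mul, htrans]
  have e13 : (∫ x, (g (x 2) - g (x 2 + h)) * ‖F x‖ ^ 2) = (∫ x, g (x 2) * ‖F x‖ ^ 2) - ∫ x, g (x 2 + h) * ‖F x‖ ^ 2 := by
    rw [← integral_sub i1 i3]
    refine integral_congr_ae (Eventually.of_forall fun x => ?_)
    ring
  rw [e13]
  ring

/-- **One-sided form** (drop the nonnegative remainder): for `g ≥ 0`,
`−∫ g(x₂)⟪F, F − F(·−he₂)⟫ ≤ ½∫(g(x₂+h) − g(x₂))‖F‖²`. [folklore] -/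
theorem neg_integral_axialWeight_inner_backwardQuotient_le (hF : Continuous F) (hF2 : Integrable (fun x => ‖F x‖ ^ 2) volume)
    (hg : Continuous g) {K : ℝ} (hgK : ∀ s, |g s| ≤ K) (hg0 : ∀ s, 0 ≤ g s) (h : ℝ) :
    -(∫ x, g (x 2) * ⟪F x, F x - F (x - h • EuclideanSpace.single (2 : Fin 3) (1 : ℝ))⟫) ≤
      (1 / 2) * ∫ x, (g (x 2 + h) - g (x 2)) * ‖F x‖ ^ 2 := by
  rw [integral_axialWeight_inner_backwardQuotient_eq hF hF2 hg hgK h]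
  have hrem : 0 ≤ ∫ x, g (x 2) * ‖F x - F (x - h • EuclideanSpace.single (2 : Fin 3) (1 : ℝ))‖ ^ 2 :=
    integral_nonneg fun x => mul_nonneg (hg0 _) (sq_nonneg _)
  have e : (∫ x, (g (x 2 + h) - g (x 2)) * ‖F x‖ ^ 2) = -∫ x, (g (x 2) - g (x 2 + h)) * ‖F x‖ ^ 2 := by
    rw [← integral_neg]
    refine integral_congr_ae (Eventually.of_forall fun x => ?_)
    ring
  rw [e]
  linarith

end ExtremiserLiouville

end Summit.NavierStokesRegularity.NavierStokesRegularity.Theorems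

end
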